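import Summits.Ventures.LatticeQCDFlow.Scaling.SectorExactMixing
import Summits.Ventures.LatticeQCDFlow.Scaling.SectorExactTwoStepStaleSet

/-!
HONEST FRAMING: exact (Metropolis-corrected) sampling algorithms for lattice gauge theory; figures
of merit are autocorrelation/cost numbers at stated couplings and volumes; no continuum-physics
claim.

# SectorExactHubDominationLaw — THE COLD-START LAW OF THE PERSISTENT HUB WITH SECTOR-EXACT FLOWS ON A GENERAL STATE SPACE UNDER THE
# DOMINATION CONSTANT ALONE (`p·cin_r ≤ 1`, `p·cout_r ≤ 1`): `d(n) ≤ 2((θ+K)/θ)·(1 − δ)^{⌊n/2⌋}`,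
# `δ = min{(1−t)w_0(1−θ)·p·ct/m, ((1−t)w_0θ − (1−θ)t)/(K+θ)}`; AT `θ = 2t/(2t+h)`: `t_mix(ε) ≤ 2⌈ρ⁻¹·log(2(1 + K(2t+h)/(2t))/ε)⌉`,
# `ρ = (th/(2t+h))·min{hpc/m, 1/(K+1)}` — UNIFORM IN THE SECTOR WEIGHTS GIVEN `p`; NO VOLUME, NO REGIME (lean-2 GEN-30, ours)

Venture-side (OURS).  Cell `lqcd-flow` (pub-lqcd), unit `pub-lqcd-lean-2-g30`, 2026-08-28.  Chapter Q (item 1 for sector-exact maps on a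
general `S`), file 13 — the numbers without the sector-weight quality.  `Scaling/SectorExactMixing` (file 6) has the rate `(1−θ)·a·ct/m` with
`a = min_r min{1, cin_r/cout_r, cout_r/cin_r}`; when a sector is nearly uncharged at some cold level relative to the hub, `a → 0` at fixed
domination constant although the chain is not slow (the unlikely entry is rarely needed).  Here both halves of file 5's decomposition are
bounded with the domination constant instead: the stale mass by `Scaling/SectorExactAveragedStaleSet` ∕ `…TwoStepStaleSet` (one-sided domination
`p·μ_{κ_r+1}(φ_r u) ≤ μ_0(u)`, i.e. `p·cin_r ≤ 1` and `p·cout_r ≤ 1`), the label chain by `Scaling/BooleanStarHubDominationLaw` (hub domination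
of the label laws, `p·μ^B_k ≤ μ^B_0`, which follows by summing sector-exactness over a sector: `μ^B_{κ_r+1}(b) = c_r(b)·μ^B_0(b)`).

## What is proved

* `twoSector_dom` (one-sided domination of the scheme from `p·cin_r, p·cout_r ≤ 1`), `boolLabel_dom` (hub domination of the label laws,
  every cold level on the hub list);
* **`sectorExact_worstTvDist_le_dom`** — **`d(n) ≤ 2((θ+K)/θ)·(1 − min{(1−t)w_0(1−θ)pct/m, ((1−t)w_0θ−(1−θ)t)/(K+θ)})^{⌊n/2⌋}`** for: a finite `S`,
  a sector `A` charged by every law, positive probability vectors `μ_k`, a hub list with multiplicities `≥ c ≥ 1`, entry maps preserving `A` with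
  `μ_{κ_r+1}(φ_r u) = c_r(u)μ_0(u)` (`c_r = cin_r` on `A`, `cout_r` off `A`, positive, `p·cin_r ≤ 1`, `p·cout_r ≤ 1`, `p ≥ 0`), exact hot
  redraws, `μ_k`-stationary row-stochastic sector-confined cold kernels, `0 ≤ t ≤ 1`, `w` a probability vector, `0 < θ ≤ 1`, `(1−θ)t ≤ (1−t)w_0θ`;
* **`sectorExact_worstTvDist_le_dom_tuned`** (`θ = 2t/(2t+h)`, `0 < t < 1`, `w_0 > 0`) and **`sectorExact_mixingTime_le_dom`**:
  **`t_mix(ε) ≤ 2⌈ρ⁻¹·log(2(1 + K(2t+h)/(2t))/ε)⌉`**, `ρ = (th/(2t+h))·min{hpc/m, 1/(K+1)}` (`p > 0`);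
* **`sectorExact_worstTvDist_le_labelStar_dom`** — any number `q` of sectors (`ℓ : S → L`, `p·c_r(b) ≤ 1`):
  **`d(n) ≤ ((θ+K)/θ)(1−δ)^{⌊n/2⌋} + d_L(n)`**, `d_L` the worst-case distance of the `q`-point label star — file 5's reduction with the stale term free
  of the acceptance floor: item 1 for partition-exact flows under the domination constant IS item 1 for the `q`-point star.

Reading (no numerics implied): the topological-freezing use case of item 1 — within-sector samplers on `K` cold replicas, a flow hub that
reproduces each sector's shape and misses only the sector weights, by at most the factor `1/p` from above — has worst-start mixing time
`O((K + m/(hpc))·(1/t + 1/h)·log(K/ε))` with NOTHING of `|S|`, `π̃_min`, the sector weights beyond `p`, or a regime; file 6 keeps the better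
entry rate `ac/m` when the weights are balanced (`a` close to `1`).  NOT CLAIMED: flows inexact within a sector; cold kernels crossing sectors;
anything measured.  Literature grade (cell rule): OWN; nothing cited as a fact; no new bib keys.
-/

noncomputable section

open Finset Function
open Literature.Probability.MarkovChains

namespace Summit.Ventures.LatticeQCDFlow.Scaling

variable {S : Type*} [Fintype S] [DecidableEq S] {K m : ℕ} {μ : Fin (K + 1) → S → ℝ} {M : Fin (K + 1) → S → S → ℝ}
  {w : Fin (K + 1) → ℝ} {t : ℝ}

section DomMixing
variable (κ : Fin m → Fin K) (φ : Fin m → Equiv.Perm S) (A : Finset S)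

omit [Fintype S] in
/-- `p·cin_r ≤ 1` and `p·cout_r ≤ 1` give the one-sided domination `p·μ_{κ_r+1}(φ_r u) ≤ μ_0(u)` (`μ_0 ≥ 0`). [ours] -/
theorem twoSector_dom (hμ : ∀ k x, 0 < μ k x) {cin cout : Fin m → ℝ}
    (hexact : ∀ r u, μ (κ r).succ (φ r u) = (if u ∈ A then cin r else cout r) * μ 0 u)
    {p : ℝ} (hpc : ∀ r, p * cin r ≤ 1 ∧ p * cout r ≤ 1) (r : Fin m) (u : S) :
    p * μ (κ r).succ (φ r u) ≤ μ 0 u := by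
  rw [hexact r u]
  have h0 := (hμ 0 u).le
  split_ifs with hu
  · calc p * (cin r * μ 0 u) = (p * cin r) * μ 0 u := by ring
      _ ≤ 1 * μ 0 u := mul_le_mul_of_nonneg_right (hpc r).1 h0
      _ = μ 0 u := one_mul _
  · calc p * (cout r * μ 0 u) = (p * cout r) * μ 0 u := by ring
      _ ≤ 1 * μ 0 u := mul_le_mul_of_nonneg_right (hpc r).2 h0
      _ = μ 0 u := one_mul _

/-- **Hub domination of the label laws:** with every cold level on the hub list (`c ≥ 1`), `p·μ^B_k(b) ≤ μ^B_0(b)` for every cold `k` and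
label `b` (`μ^B_{κ_r+1}(b) = c_r(b)·μ^B_0(b)` by `sectorExact_labelMass`, and `p·c_r(b) ≤ 1`). [ours] -/
theorem boolLabel_dom (hφA : ∀ r u, φ r u ∈ A ↔ u ∈ A) {cin cout : Fin m → ℝ} (hcin : ∀ r, 0 < cin r) (hcout : ∀ r, 0 < cout r)
    (hexact : ∀ r u, μ (κ r).succ (φ r u) = (if u ∈ A then cin r else cout r) * μ 0 u)
    {μB : Fin (K + 1) → Bool → ℝ} (hμB : ∀ k b, μB k b = ∑ u ∈ univ.filter (fun u => decide (u ∈ A) = b), μ k u)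
    (hμB0 : ∀ k b, 0 < μB k b) {p : ℝ} (hpc : ∀ r, p * cin r ≤ 1 ∧ p * cout r ≤ 1)
    {c : ℕ} (hc1 : 1 ≤ c) (hc : ∀ p' : Fin K, c ≤ (univ.filter (fun r : Fin m => κ r = p')).card) (j : Fin K) (b : Bool) :
    p * μB j.succ b ≤ μB 0 b := by
  obtain ⟨hφℓ, -, hexact'⟩ := twoSector_asLabels κ φ A hφA hcin hcout hexact
  obtain ⟨r, hr⟩ := Finset.card_pos.mp (lt_of_lt_of_le Nat.one_pos (hc1.trans (hc j)))
  have hrj : κ r = j := (Finset.mem_filter.mp hr).2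
  rw [← hrj, hμB, hμB, sectorExact_labelMass κ φ (fun u => decide (u ∈ A)) hφℓ
    (cL := fun (r : Fin m) (b : Bool) => if b = true then cin r else cout r) hexact' r b]
  have hX : 0 < ∑ u ∈ univ.filter (fun u => decide (u ∈ A) = b), μ 0 u := by rw [← hμB]; exact hμB0 0 b
  have hpc' : p * (fun (r : Fin m) (b : Bool) => if b = true then cin r else cout r) r b ≤ 1 := by
    dsimp only; split_ifs; exacts [(hpc r).1, (hpc r).2]
  calc p * ((fun (r : Fin m) (b : Bool) => if b = true then cin r else cout r) r b
        * ∑ u ∈ univ.filter (fun u => decide (u ∈ A) = b), μ 0 u)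
      = (p * (fun (r : Fin m) (b : Bool) => if b = true then cin r else cout r) r b)
        * ∑ u ∈ univ.filter (fun u => decide (u ∈ A) = b), μ 0 u := by ring
    _ ≤ 1 * ∑ u ∈ univ.filter (fun u => decide (u ∈ A) = b), μ 0 u := mul_le_mul_of_nonneg_right hpc' hX.le
    _ = _ := one_mul _

/-- **THE COLD-START LAW WITH SECTOR-EXACT FLOWS UNDER THE DOMINATION CONSTANT ALONE, GENERAL `S`:**
**`d(n) ≤ 2((θ+K)/θ)·(1 − min{(1−t)w_0(1−θ)·p·c·t/m, ((1−t)w_0·θ − (1−θ)t)/(K+θ)})^{⌊n/2⌋}`** — no volume, no regime, no sector-weight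
quality, polynomial in `K`. [ours] -/
theorem sectorExact_worstTvDist_le_dom (hm : 1 ≤ m) (ht0 : 0 ≤ t) (ht1 : t ≤ 1) (hw0 : ∀ k, 0 ≤ w k) (hw1 : ∑ k, w k = 1)
    (hμ : ∀ k x, 0 < μ k x) (hμ1 : ∀ k, ∑ u, μ k u = 1) (hφA : ∀ r u, φ r u ∈ A ↔ u ∈ A) {cin cout : Fin m → ℝ}
    (hcin : ∀ r, 0 < cin r) (hcout : ∀ r, 0 < cout r) (hexact : ∀ r u, μ (κ r).succ (φ r u) = (if u ∈ A then cin r else cout r) * μ 0 u)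
    (hM : ∀ k, IsRowStochastic (M k)) (hM0 : ∀ u v, M 0 u v = μ 0 v)
    (hstat : ∀ k : Fin (K + 1), k ≠ 0 → ∀ v, ∑ u, μ k u * M k u v = μ k v)
    (hconf : ∀ k : Fin (K + 1), k ≠ 0 → ∀ u v, ¬(u ∈ A ↔ v ∈ A) → M k u v = 0)
    (hA : ∀ k b, 0 < ∑ u ∈ univ.filter (fun u => decide (u ∈ A) = b), μ k u)
    {p θ : ℝ} (hp0 : 0 ≤ p) (hpc : ∀ r, p * cin r ≤ 1 ∧ p * cout r ≤ 1) (hθ0 : 0 < θ) (hθ1 : θ ≤ 1)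
    (hreg : (1 - θ) * t ≤ (1 - t) * w 0 * θ)
    {c : ℕ} (hc1 : 1 ≤ c) (hc : ∀ p' : Fin K, c ≤ (univ.filter (fun r : Fin m => κ r = p')).card) (n : ℕ) :
    worstTvDist (fun y z : Fin (K + 1) → S =>
        t * ptGraphSwap μ (fun r : Fin m => (((0 : Fin (K + 1)), (κ r).succ) : Fin (K + 1) × Fin (K + 1))) φ y z
          + (1 - t) * prodKernel w M y z) (tensorFun μ) n
      ≤ 2 * ((θ + K) / θ)
        * (1 - min ((1 - t) * w 0 * (1 - θ) * p * c * t / m) (((1 - t) * w 0 * θ - (1 - θ) * t) / (K + θ))) ^ (n / 2) := by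
  set μB : Fin (K + 1) → Bool → ℝ := fun k b => ∑ u ∈ univ.filter (fun u => decide (u ∈ A) = b), μ k u with hμBd
  have hμB : ∀ k b, μB k b = ∑ u ∈ univ.filter (fun u => decide (u ∈ A) = b), μ k u := fun _ _ => rfl
  have hμB0 : ∀ k b, 0 < μB k b := hA
  obtain ⟨hμB1, hMB, hMBrev⟩ := boolLabel_basic A hμ1 hμB hμB0
  set δ := min ((1 - t) * w 0 * (1 - θ) * p * c * t / m) (((1 - t) * w 0 * θ - (1 - θ) * t) / (K + θ)) with hδ
  have hαrfl : ∀ r z, (fun r z => min 1 (tensorFun μ (edgeFlowSwap (φ r) 0 (κ r).succ z) / tensorFun μ z)) r z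
      = min 1 (tensorFun μ (edgeFlowSwap (φ r) 0 (κ r).succ z) / tensorFun μ z) := fun _ _ => rfl
  obtain ⟨hφℓ, hcL, hexact'⟩ := twoSector_asLabels κ φ A hφA hcin hcout hexact
  have hconf' : ∀ k : Fin (K + 1), k ≠ 0 → ∀ u v : S, (fun u => decide (u ∈ A)) u ≠ (fun u => decide (u ∈ A)) v → M k u v = 0 :=
    fun k hk u v huv => hconf k hk u v (fun h => huv (by dsimp only; rw [decide_eq_decide]; exact h))
  have hdom : ∀ r u, p * μ (κ r).succ (φ r u) ≤ μ 0 u := twoSector_dom κ φ A hμ hexact hpc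
  have hpB : ∀ (j : Fin K) (b : Bool), p * μB j.succ b ≤ μB 0 b :=
    boolLabel_dom κ φ A hφA hcin hcout hexact hμB hμB0 hpc hc1 hc
  -- the Boolean star's law for the labels, under hub domination
  have hB := boolStar_worstTvDist_le_dom κ (μ := μB)
    (M := fun (k : Fin (K + 1)) (u v : Bool) => if k = 0 then μB 0 v else (if u = v then (1 : ℝ) else 0)) (w := w)
    hm ht0 ht1 hw0 hw1 hμB0 hμB1 hMB hMBrev (fun u v => by simp) hθ0 hθ1 hreg hc hp0 hpB n
  have hnonneg : 0 ≤ 2 * ((θ + K) / θ) * (1 - δ) ^ (n / 2) := by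
    have : 0 ≤ (θ + K) / θ * (1 - δ) ^ (n / 2) := (worstTvDist_nonneg _ _ n).trans hB
    linarith
  refine Real.iSup_le (fun x => ?_) hnonneg
  have hdec := sectorExact_tvDist_le κ φ (fun u => decide (u ∈ A)) hm ht0 ht1 hw0 hw1 hμ hφℓ hcL hexact' hM hM0 hstat hconf' hμB hμB0
    (Ph := fun a b => ∑ r : Fin m, t / m *
        ((fun r a => (fun r z => min 1 (tensorFun μ (edgeFlowSwap (φ r) 0 (κ r).succ z) / tensorFun μ z)) r a.1) r a
            * (if b.1 = edgeFlowSwap (φ r) 0 (κ r).succ a.1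
            ∧ b.2 = a.2.image (Equiv.swap (0 : Fin (K + 1)) (κ r).succ) then (1 : ℝ) else 0)
          + ((fun r z => min 1 (tensorFun μ (edgeFlowSwap (φ r) 0 (κ r).succ z) / tensorFun μ z)) r a.1
              - (fun r a => (fun r z => min 1 (tensorFun μ (edgeFlowSwap (φ r) 0 (κ r).succ z) / tensorFun μ z)) r a.1) r a)
            * (if b.1 = edgeFlowSwap (φ r) 0 (κ r).succ a.1
              ∧ b.2 = (fun (_ : Fin m) (D : Finset (Fin (K + 1))) => D) r a.2 then (1 : ℝ) else 0)
          + (1 - (fun r z => min 1 (tensorFun μ (edgeFlowSwap (φ r) 0 (κ r).succ z) / tensorFun μ z)) r a.1)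
            * (if b.1 = a.1 ∧ b.2 = (fun (_ : Fin m) (D : Finset (Fin (K + 1))) => D) r a.2 then (1 : ℝ) else 0))
      + (1 - t) * ∑ k : Fin (K + 1), w k * (coordKernel M k a.1 b.1
          * (if b.2 = (if k = 0 then a.2.erase 0 else a.2) then (1 : ℝ) else 0)))
    (fun _ _ => rfl) x n
  have hstale := sectorAug_stale_le_dom κ φ hm ht0 ht1 hw0 hw1 hM hM0 hμ hμ1 hαrfl hp0 hdom hθ0 hθ1 hreg hc
    (Ph := fun a b => ∑ r : Fin m, t / m *
        ((fun r a => (fun r z => min 1 (tensorFun μ (edgeFlowSwap (φ r) 0 (κ r).succ z) / tensorFun μ z)) r a.1) r a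
            * (if b.1 = edgeFlowSwap (φ r) 0 (κ r).succ a.1
            ∧ b.2 = a.2.image (Equiv.swap (0 : Fin (K + 1)) (κ r).succ) then (1 : ℝ) else 0)
          + ((fun r z => min 1 (tensorFun μ (edgeFlowSwap (φ r) 0 (κ r).succ z) / tensorFun μ z)) r a.1
              - (fun r a => (fun r z => min 1 (tensorFun μ (edgeFlowSwap (φ r) 0 (κ r).succ z) / tensorFun μ z)) r a.1) r a)
            * (if b.1 = edgeFlowSwap (φ r) 0 (κ r).succ a.1
              ∧ b.2 = (fun (_ : Fin m) (D : Finset (Fin (K + 1))) => D) r a.2 then (1 : ℝ) else 0)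
          + (1 - (fun r z => min 1 (tensorFun μ (edgeFlowSwap (φ r) 0 (κ r).succ z) / tensorFun μ z)) r a.1)
            * (if b.1 = a.1 ∧ b.2 = (fun (_ : Fin m) (D : Finset (Fin (K + 1))) => D) r a.2 then (1 : ℝ) else 0))
      + (1 - t) * ∑ k : Fin (K + 1), w k * (coordKernel M k a.1 b.1
          * (if b.2 = (if k = 0 then a.2.erase 0 else a.2) then (1 : ℝ) else 0)))
    (fun _ _ => rfl) x n
  have hlabel := (tvDist_single_le_worstTvDist _ _ n (fun k => decide (x k ∈ A))).trans hB
  calc _ ≤ _ := hdec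
    _ ≤ (θ + K) / θ * (1 - δ) ^ (n / 2) + (θ + K) / θ * (1 - δ) ^ (n / 2) := add_le_add hstale hlabel
    _ = 2 * ((θ + K) / θ) * (1 - δ) ^ (n / 2) := by ring

/-- **THE TUNED LAW UNDER THE DOMINATION CONSTANT** (`θ = 2t/(2t+h)`, `h = (1−t)w_0`; `0 < t < 1`, `w_0 > 0`, `p ≥ 0`):
**`d(n) ≤ 2(1 + K(2t+h)/(2t))·(1 − (th/(2t+h))·min{hpc/m, 1/(K+1)})^{⌊n/2⌋}`**. [ours] -/
theorem sectorExact_worstTvDist_le_dom_tuned (hm : 1 ≤ m) (ht0 : 0 < t) (ht1 : t < 1) (hw0 : ∀ k, 0 ≤ w k) (hw00 : 0 < w 0)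
    (hw1 : ∑ k, w k = 1) (hμ : ∀ k x, 0 < μ k x) (hμ1 : ∀ k, ∑ u, μ k u = 1) (hφA : ∀ r u, φ r u ∈ A ↔ u ∈ A) {cin cout : Fin m → ℝ}
    (hcin : ∀ r, 0 < cin r) (hcout : ∀ r, 0 < cout r) (hexact : ∀ r u, μ (κ r).succ (φ r u) = (if u ∈ A then cin r else cout r) * μ 0 u)
    (hM : ∀ k, IsRowStochastic (M k)) (hM0 : ∀ u v, M 0 u v = μ 0 v)
    (hstat : ∀ k : Fin (K + 1), k ≠ 0 → ∀ v, ∑ u, μ k u * M k u v = μ k v)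
    (hconf : ∀ k : Fin (K + 1), k ≠ 0 → ∀ u v, ¬(u ∈ A ↔ v ∈ A) → M k u v = 0)
    (hA : ∀ k b, 0 < ∑ u ∈ univ.filter (fun u => decide (u ∈ A) = b), μ k u)
    {p : ℝ} (hp0 : 0 ≤ p) (hpc : ∀ r, p * cin r ≤ 1 ∧ p * cout r ≤ 1)
    {c : ℕ} (hc1 : 1 ≤ c) (hc : ∀ p' : Fin K, c ≤ (univ.filter (fun r : Fin m => κ r = p')).card) (n : ℕ) :
    worstTvDist (fun y z : Fin (K + 1) → S =>
        t * ptGraphSwap μ (fun r : Fin m => (((0 : Fin (K + 1)), (κ r).succ) : Fin (K + 1) × Fin (K + 1))) φ y z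
          + (1 - t) * prodKernel w M y z) (tensorFun μ) n
      ≤ 2 * (1 + K * (2 * t + (1 - t) * w 0) / (2 * t))
        * (1 - t * ((1 - t) * w 0) / (2 * t + (1 - t) * w 0)
          * min ((1 - t) * w 0 * p * c / m) (1 / (K + 1))) ^ (n / 2) := by
  set h := (1 - t) * w 0 with hh
  have hh0 : 0 < h := mul_pos (by linarith) hw00
  set θ := 2 * t / (2 * t + h) with hθ
  have hθ0 : 0 < θ := by positivity
  have hθ1 : θ ≤ 1 := by rw [hθ, div_le_one (by positivity)]; linarith
  have h1θ : 1 - θ = h / (2 * t + h) := by rw [hθ]; field_simp; ring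
  have hreg : (1 - θ) * t ≤ (1 - t) * w 0 * θ := by
    rw [h1θ, ← hh, hθ]
    rw [div_mul_eq_mul_div, mul_div_assoc', div_le_div_iff_of_pos_right (by positivity)]
    nlinarith [mul_pos ht0 hh0]
  have hmain := sectorExact_worstTvDist_le_dom κ φ A hm ht0.le ht1.le hw0 hw1 hμ hμ1 hφA hcin hcout hexact hM hM0 hstat hconf hA hp0 hpc
    hθ0 hθ1 hreg hc1 hc n
  have hmpos : (0 : ℝ) < m := Nat.cast_pos.mpr (by omega)
  have hrate : t * h / (2 * t + h) * min (h * p * c / m) (1 / (K + 1))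
      ≤ min ((1 - t) * w 0 * (1 - θ) * p * c * t / m) (((1 - t) * w 0 * θ - (1 - θ) * t) / (K + θ)) := by
    refine le_min ?_ ?_
    · calc t * h / (2 * t + h) * min (h * p * c / m) (1 / (K + 1)) ≤ t * h / (2 * t + h) * (h * p * c / m) :=
            mul_le_mul_of_nonneg_left (min_le_left _ _) (by positivity)
        _ = (1 - t) * w 0 * (1 - θ) * p * c * t / m := by rw [h1θ, ← hh]; ring
    · calc t * h / (2 * t + h) * min (h * p * c / m) (1 / (K + 1)) ≤ t * h / (2 * t + h) * (1 / (K + 1)) :=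
            mul_le_mul_of_nonneg_left (min_le_right _ _) (by positivity)
        _ ≤ t * h / (2 * t + h) * (1 / (K + θ)) := by gcongr
        _ = ((1 - t) * w 0 * θ - (1 - θ) * t) / (K + θ) := by rw [← hh, h1θ, hθ]; field_simp; ring
  have hconst : (θ + K) / θ = 1 + K * (2 * t + h) / (2 * t) := by rw [hθ]; field_simp
  have hbase0 : 0 ≤ 1 - min ((1 - t) * w 0 * (1 - θ) * p * c * t / m) (((1 - t) * w 0 * θ - (1 - θ) * t) / (K + θ)) := by
    have h2 : min ((1 - t) * w 0 * (1 - θ) * p * c * t / m) (((1 - t) * w 0 * θ - (1 - θ) * t) / (K + θ))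
        ≤ ((1 - t) * w 0 * θ - (1 - θ) * t) / (K + θ) := min_le_right _ _
    have h3 : ((1 - t) * w 0 * θ - (1 - θ) * t) / (K + θ) ≤ 1 := by
      rw [div_le_one (by positivity)]
      have hw01 : w 0 ≤ 1 := by
        calc w 0 ≤ ∑ k, w k := Finset.single_le_sum (fun k _ => hw0 k) (mem_univ 0)
          _ = 1 := hw1
      nlinarith [mul_nonneg (sub_nonneg.mpr ht1.le) (hw0 0), mul_nonneg (sub_nonneg.mpr hθ1) ht0.le, hθ0.le,
        mul_le_mul_of_nonneg_left hw01 (sub_nonneg.mpr ht1.le), Nat.cast_nonneg (α := ℝ) K]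
    linarith
  calc _ ≤ 2 * ((θ + K) / θ) * (1 - min ((1 - t) * w 0 * (1 - θ) * p * c * t / m)
        (((1 - t) * w 0 * θ - (1 - θ) * t) / (K + θ))) ^ (n / 2) := hmain
    _ ≤ 2 * (1 + K * (2 * t + h) / (2 * t)) * (1 - t * h / (2 * t + h) * min (h * p * c / m) (1 / (K + 1))) ^ (n / 2) := by
        rw [hconst]
        exact mul_le_mul_of_nonneg_left (pow_le_pow_left₀ hbase0 (by linarith [hrate]) _) (by positivity)

/-- **THE MIXING TIME WITH SECTOR-EXACT FLOWS UNDER THE DOMINATION CONSTANT:** `ρ = (th/(2t+h))·min{hpc/m, 1/(K+1)}` (`h = (1−t)w_0`,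
`p > 0`, `c ≥ 1`): **`t_mix(ε) ≤ 2⌈ρ⁻¹·log(2(1 + K(2t+h)/(2t))/ε)⌉`** — `O((K + m/(hpc))·(1/t + 1/h)·log(K/ε))`, free of `|S|`, `π̃_min` and
the sector weights beyond `p`. [ours] -/
theorem sectorExact_mixingTime_le_dom (hm : 1 ≤ m) (ht0 : 0 < t) (ht1 : t < 1) (hw0 : ∀ k, 0 ≤ w k) (hw00 : 0 < w 0)
    (hw1 : ∑ k, w k = 1) (hμ : ∀ k x, 0 < μ k x) (hμ1 : ∀ k, ∑ u, μ k u = 1) (hφA : ∀ r u, φ r u ∈ A ↔ u ∈ A) {cin cout : Fin m → ℝ}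
    (hcin : ∀ r, 0 < cin r) (hcout : ∀ r, 0 < cout r) (hexact : ∀ r u, μ (κ r).succ (φ r u) = (if u ∈ A then cin r else cout r) * μ 0 u)
    (hM : ∀ k, IsRowStochastic (M k)) (hM0 : ∀ u v, M 0 u v = μ 0 v)
    (hstat : ∀ k : Fin (K + 1), k ≠ 0 → ∀ v, ∑ u, μ k u * M k u v = μ k v)
    (hconf : ∀ k : Fin (K + 1), k ≠ 0 → ∀ u v, ¬(u ∈ A ↔ v ∈ A) → M k u v = 0)
    (hA : ∀ k b, 0 < ∑ u ∈ univ.filter (fun u => decide (u ∈ A) = b), μ k u)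
    {p : ℝ} (hp0 : 0 < p) (hpc : ∀ r, p * cin r ≤ 1 ∧ p * cout r ≤ 1)
    {c : ℕ} (hc1 : 1 ≤ c) (hc : ∀ p' : Fin K, c ≤ (univ.filter (fun r : Fin m => κ r = p')).card) {ε : ℝ} (hε : 0 < ε) :
    mixingTime (fun y z : Fin (K + 1) → S =>
        t * ptGraphSwap μ (fun r : Fin m => (((0 : Fin (K + 1)), (κ r).succ) : Fin (K + 1) × Fin (K + 1))) φ y z
          + (1 - t) * prodKernel w M y z) (tensorFun μ) ε
      ≤ 2 * ⌈1 / (t * ((1 - t) * w 0) / (2 * t + (1 - t) * w 0) * min ((1 - t) * w 0 * p * c / m) (1 / (K + 1)))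
          * Real.log (2 * (1 + K * (2 * t + (1 - t) * w 0) / (2 * t)) / ε)⌉₊ := by
  set h := (1 - t) * w 0 with hh
  have hh0 : 0 < h := mul_pos (by linarith) hw00
  have hmpos : (0 : ℝ) < m := Nat.cast_pos.mpr (by omega)
  set ρ := t * h / (2 * t + h) * min (h * p * c / m) (1 / (K + 1)) with hρ
  have hρ0 : 0 < ρ := by
    have : 0 < min (h * p * c / (m : ℝ)) (1 / ((K : ℝ) + 1)) := lt_min (by positivity) (by positivity)
    positivity
  have hρ1 : ρ ≤ 1 := by
    have h1 : t * h / (2 * t + h) ≤ 1 := by rw [div_le_one (by positivity)]; nlinarith [mul_pos ht0 hh0]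
    have h2 : min (h * p * c / (m : ℝ)) (1 / ((K : ℝ) + 1)) ≤ 1 := (min_le_right _ _).trans (by
      rw [div_le_one (by positivity)]; linarith [Nat.cast_nonneg (α := ℝ) K])
    have h3 : 0 ≤ min (h * p * c / (m : ℝ)) (1 / ((K : ℝ) + 1)) := le_min (by positivity) (by positivity)
    calc ρ ≤ 1 * 1 := mul_le_mul h1 h2 h3 zero_le_one
      _ = 1 := one_mul 1
  set N : ℕ := ⌈1 / ρ * Real.log (2 * (1 + K * (2 * t + h) / (2 * t)) / ε)⌉₊ with hN
  have hd := sectorExact_worstTvDist_le_dom_tuned κ φ A hm ht0 ht1 hw0 hw00 hw1 hμ hμ1 hφA hcin hcout hexact hM hM0 hstat hconf hA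
    hp0.le hpc hc1 hc (2 * N)
  rw [show 2 * N / 2 = N by omega] at hd
  refine mixingTime_le _ _ (hd.trans ?_)
  exact geom_le_of_ge_log hρ0 hρ1 (by positivity) hε (Nat.le_ceil _)

end DomMixing

section DomLabelStar
variable (κ : Fin m → Fin K) (φ : Fin m → Equiv.Perm S) {L : Type*} [Fintype L] [DecidableEq L] (ℓ : S → L)

/-- **THE REDUCTION TO THE LABEL STAR UNDER THE DOMINATION CONSTANT ALONE (any number of sectors):** for maps exact on every sector of a
partition `ℓ : S → L` (labels preserved, `μ_l(φ_r u) = c_r(ℓ u)μ_0(u)` with `p·c_r(b) ≤ 1`, `p ≥ 0`), exact hot redraws and `μ_k`-stationary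
sector-confined cold kernels, `0 < θ ≤ 1`, `(1−θ)t ≤ (1−t)w_0θ`, hub multiplicities `≥ c`:
**`d(n) ≤ ((θ+K)/θ)·(1 − min{(1−t)w_0(1−θ)pct/m, ((1−t)w_0θ − (1−θ)t)/(K+θ)})^{⌊n/2⌋} + d_L(n)`**, `d_L` the worst-case distance of the label
star on `L` — NO acceptance floor in the stale term.  OPEN-MATH item 1 for partition-exact flows with `q` sectors under the domination constant
IS item 1 for the `q`-point star. [ours] -/
theorem sectorExact_worstTvDist_le_labelStar_dom (hm : 1 ≤ m) (ht0 : 0 ≤ t) (ht1 : t ≤ 1) (hw0 : ∀ k, 0 ≤ w k) (hw1 : ∑ k, w k = 1)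
    (hμ : ∀ k x, 0 < μ k x) (hμ1 : ∀ k, ∑ u, μ k u = 1) (hφℓ : ∀ r u, ℓ (φ r u) = ℓ u) {cL : Fin m → L → ℝ}
    (hcL : ∀ r b, 0 < cL r b) (hexact : ∀ r u, μ (κ r).succ (φ r u) = cL r (ℓ u) * μ 0 u)
    (hM : ∀ k, IsRowStochastic (M k)) (hM0 : ∀ u v, M 0 u v = μ 0 v)
    (hstat : ∀ k : Fin (K + 1), k ≠ 0 → ∀ v, ∑ u, μ k u * M k u v = μ k v)
    (hconf : ∀ k : Fin (K + 1), k ≠ 0 → ∀ u v, ℓ u ≠ ℓ v → M k u v = 0)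
    {μB : Fin (K + 1) → L → ℝ} (hμB : ∀ k b, μB k b = ∑ u ∈ univ.filter (fun u => ℓ u = b), μ k u)
    (hμB0 : ∀ k b, 0 < μB k b) {p θ : ℝ} (hp0 : 0 ≤ p) (hpc : ∀ r b, p * cL r b ≤ 1) (hθ0 : 0 < θ) (hθ1 : θ ≤ 1)
    (hreg : (1 - θ) * t ≤ (1 - t) * w 0 * θ) {c : ℕ} (hc : ∀ p' : Fin K, c ≤ (univ.filter (fun r : Fin m => κ r = p')).card) (n : ℕ) :
    worstTvDist (fun y z : Fin (K + 1) → S =>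
        t * ptGraphSwap μ (fun r : Fin m => (((0 : Fin (K + 1)), (κ r).succ) : Fin (K + 1) × Fin (K + 1))) φ y z
          + (1 - t) * prodKernel w M y z) (tensorFun μ) n
      ≤ (θ + K) / θ * (1 - min ((1 - t) * w 0 * (1 - θ) * p * c * t / m) (((1 - t) * w 0 * θ - (1 - θ) * t) / (K + θ))) ^ (n / 2)
        + worstTvDist (fun y s : Fin (K + 1) → L =>
            t * ptGraphSwap μB (fun r : Fin m => (((0 : Fin (K + 1)), (κ r).succ) : Fin (K + 1) × Fin (K + 1)))
                (fun _ : Fin m => Equiv.refl L) y s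
              + (1 - t) * prodKernel w (fun (k : Fin (K + 1)) (u v : L) => if k = 0 then μB 0 v else (if u = v then (1 : ℝ) else 0)) y s)
          (tensorFun μB) n := by
  have hαrfl : ∀ r z, (fun r z => min 1 (tensorFun μ (edgeFlowSwap (φ r) 0 (κ r).succ z) / tensorFun μ z)) r z
      = min 1 (tensorFun μ (edgeFlowSwap (φ r) 0 (κ r).succ z) / tensorFun μ z) := fun _ _ => rfl
  have hdom : ∀ r u, p * μ (κ r).succ (φ r u) ≤ μ 0 u := fun r u => by
    rw [hexact r u]
    calc p * (cL r (ℓ u) * μ 0 u) = (p * cL r (ℓ u)) * μ 0 u := by ring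
      _ ≤ 1 * μ 0 u := mul_le_mul_of_nonneg_right (hpc r _) (hμ 0 u).le
      _ = μ 0 u := one_mul _
  set δ := min ((1 - t) * w 0 * (1 - θ) * p * c * t / m) (((1 - t) * w 0 * θ - (1 - θ) * t) / (K + θ)) with hδ
  have hnonneg : 0 ≤ (θ + K) / θ * (1 - δ) ^ (n / 2)
      + worstTvDist (fun y s : Fin (K + 1) → L =>
            t * ptGraphSwap μB (fun r : Fin m => (((0 : Fin (K + 1)), (κ r).succ) : Fin (K + 1) × Fin (K + 1)))
                (fun _ : Fin m => Equiv.refl L) y s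
              + (1 - t) * prodKernel w (fun (k : Fin (K + 1)) (u v : L) => if k = 0 then μB 0 v else (if u = v then (1 : ℝ) else 0)) y s)
          (tensorFun μB) n := by
    have hδ1 : 0 ≤ 1 - δ := by
      have h2 : δ ≤ ((1 - t) * w 0 * θ - (1 - θ) * t) / (K + θ) := min_le_right _ _
      have h3 : ((1 - t) * w 0 * θ - (1 - θ) * t) / (K + θ) ≤ 1 := by
        rw [div_le_one (by positivity)]
        have hw01 : w 0 ≤ 1 := by
          calc w 0 ≤ ∑ k, w k := Finset.single_le_sum (fun k _ => hw0 k) (mem_univ 0)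
            _ = 1 := hw1
        nlinarith [mul_nonneg (sub_nonneg.mpr ht1) (hw0 0), mul_nonneg (sub_nonneg.mpr hθ1) ht0, hθ0.le,
          mul_le_mul_of_nonneg_left hw01 (sub_nonneg.mpr ht1), Nat.cast_nonneg (α := ℝ) K]
      linarith
    exact add_nonneg (mul_nonneg (by positivity) (pow_nonneg hδ1 _)) (worstTvDist_nonneg _ _ n)
  refine Real.iSup_le (fun x => ?_) hnonneg
  have hdec := sectorExact_tvDist_le κ φ ℓ hm ht0 ht1 hw0 hw1 hμ hφℓ hcL hexact hM hM0 hstat hconf hμB hμB0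
    (Ph := fun a b => ∑ r : Fin m, t / m *
        ((fun r a => (fun r z => min 1 (tensorFun μ (edgeFlowSwap (φ r) 0 (κ r).succ z) / tensorFun μ z)) r a.1) r a
            * (if b.1 = edgeFlowSwap (φ r) 0 (κ r).succ a.1
            ∧ b.2 = a.2.image (Equiv.swap (0 : Fin (K + 1)) (κ r).succ) then (1 : ℝ) else 0)
          + ((fun r z => min 1 (tensorFun μ (edgeFlowSwap (φ r) 0 (κ r).succ z) / tensorFun μ z)) r a.1
              - (fun r a => (fun r z => min 1 (tensorFun μ (edgeFlowSwap (φ r) 0 (κ r).succ z) / tensorFun μ z)) r a.1) r a)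
            * (if b.1 = edgeFlowSwap (φ r) 0 (κ r).succ a.1
              ∧ b.2 = (fun (_ : Fin m) (D : Finset (Fin (K + 1))) => D) r a.2 then (1 : ℝ) else 0)
          + (1 - (fun r z => min 1 (tensorFun μ (edgeFlowSwap (φ r) 0 (κ r).succ z) / tensorFun μ z)) r a.1)
            * (if b.1 = a.1 ∧ b.2 = (fun (_ : Fin m) (D : Finset (Fin (K + 1))) => D) r a.2 then (1 : ℝ) else 0))
      + (1 - t) * ∑ k : Fin (K + 1), w k * (coordKernel M k a.1 b.1
          * (if b.2 = (if k = 0 then a.2.erase 0 else a.2) then (1 : ℝ) else 0)))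
    (fun _ _ => rfl) x n
  have hstale := sectorAug_stale_le_dom κ φ hm ht0 ht1 hw0 hw1 hM hM0 hμ hμ1 hαrfl hp0 hdom hθ0 hθ1 hreg hc
    (Ph := fun a b => ∑ r : Fin m, t / m *
        ((fun r a => (fun r z => min 1 (tensorFun μ (edgeFlowSwap (φ r) 0 (κ r).succ z) / tensorFun μ z)) r a.1) r a
            * (if b.1 = edgeFlowSwap (φ r) 0 (κ r).succ a.1
            ∧ b.2 = a.2.image (Equiv.swap (0 : Fin (K + 1)) (κ r).succ) then (1 : ℝ) else 0)
          + ((fun r z => min 1 (tensorFun μ (edgeFlowSwap (φ r) 0 (κ r).succ z) / tensorFun μ z)) r a.1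
              - (fun r a => (fun r z => min 1 (tensorFun μ (edgeFlowSwap (φ r) 0 (κ r).succ z) / tensorFun μ z)) r a.1) r a)
            * (if b.1 = edgeFlowSwap (φ r) 0 (κ r).succ a.1
              ∧ b.2 = (fun (_ : Fin m) (D : Finset (Fin (K + 1))) => D) r a.2 then (1 : ℝ) else 0)
          + (1 - (fun r z => min 1 (tensorFun μ (edgeFlowSwap (φ r) 0 (κ r).succ z) / tensorFun μ z)) r a.1)
            * (if b.1 = a.1 ∧ b.2 = (fun (_ : Fin m) (D : Finset (Fin (K + 1))) => D) r a.2 then (1 : ℝ) else 0))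
      + (1 - t) * ∑ k : Fin (K + 1), w k * (coordKernel M k a.1 b.1
          * (if b.2 = (if k = 0 then a.2.erase 0 else a.2) then (1 : ℝ) else 0)))
    (fun _ _ => rfl) x n
  have hlabel := tvDist_single_le_worstTvDist (fun y s : Fin (K + 1) → L =>
            t * ptGraphSwap μB (fun r : Fin m => (((0 : Fin (K + 1)), (κ r).succ) : Fin (K + 1) × Fin (K + 1)))
                (fun _ : Fin m => Equiv.refl L) y s
              + (1 - t) * prodKernel w (fun (k : Fin (K + 1)) (u v : L) => if k = 0 then μB 0 v else (if u = v then (1 : ℝ) else 0)) y s)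
    (tensorFun μB) n (fun k => ℓ (x k))
  linarith [hdec, hstale, hlabel]

end DomLabelStar

end Summit.Ventures.LatticeQCDFlow.Scaling

end
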